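import Summits.ABC.IUTFork.Thm311LinkSmall
import Literature.IUT.LogThetaLattice.LatticeGlueOfKits
import Literature.IUT.LogThetaLattice.RadialDataCore
import Mathlib.CategoryTheory.Core
import HarnessLib

/-!
# [IUTchIII] Theorem 3.11 in the author's terms, J3: the objects of (iii) over the REAL frame and the REAL glue (`StripFrame.ofKits`, `LatticeGlue.ofKits`) — R-c instantiated

Record-only file (D-0012) of the abc-iut cell (seat abc-iut-c312-1); TAKES NO SIDE. Sequel to J2 (`Thm311LinkSmall`: the small
model `SmallFamily`, `LinkData.ofFunctorsSmall` / `ofBiCoricSmall` over frames of ANY universe, landing in D's universe-`0`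
`Thm311.LinkData`). abc-iut-L6-t3 has landed the REAL frame `StripFrame.ofKits : StripFrame.{max 1 u}` ([IUTchIII] Def. 1.1 from
the [IUTchI] kits, the [IUTchII] Def. 4.9 side `TimesMuSide`, rigidity hypotheses [IUTchI] Cor. 5.3 (ii)(iii)), its REAL bi-coric
data `BiCoricData.ofKits` (Prop. 1.2, Thm. 1.5 (iii)–(v)) and the REAL glue `LatticeGlue.ofKits` / `LatticeGlue.ofKitsDiagram`
(Cor. 2.3 (i), Def. 1.4; "the INPUT SHAPE of `Thm311.LinkData.ofGlue` … this file removes the L6-side half of the blockage",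
`LatticeGlueOfKits`). This file removes the C312-side half WITHOUT the universe patch R-a (finding F-w5d029-1), additively:
* §0 smallness: for kits in universe `0` the frame's categories are `AsSmall.{1}` of categories with `Type`-valued hom-sets,
  hence locally `0`-small (J2 `locallySmall_asSmall`); so are `Core C` and L6's category of radial data `Radial E`;
* §1 `LinkData.ofFunctorsCoreSmall` = L's `ofFunctorsCore` (radial / `∞κ` data functorial on the CORE of the `D`-Hodge-theater
  category) in any universe through the small model; (iii)(c)/(d) AS TYPED proved (Kummer naturality + functoriality);
* §2 `LinkData.ofGlueSmall G Λ FM` = L's `ofGlueRadial` for `G : LatticeGlue S`, `S : StripFrame.{u}`, any `u` (`Fenv := G.fxmEnvD`,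
  Prop. 2.1 (vi) `:= G.envNat`, radial data `:= Radial.coreFunctor G.coric`); `FullSituation.ofGlueSmall`, `statement_iff`,
  and `FullSituation.statement_relink` (Theorem 3.11 as typed transfers to any (iii)-objects satisfying (iii)(c)(d));
* §3 at the REAL frame: `LinkData.ofKits` (over `BiCoricData.ofKits`, generic `Fenv`/`FR`/`FM`) and **`LinkData.ofKitsGlue`**
  `:= ofGlueSmall (LatticeGlue.ofKits …) (LatticeGlue.ofKitsDiagram …) FM` — the (iii)-objects of Theorem 3.11 over the REAL
  frame, bi-coric data, theta monoids and radial data, IN D's SIGNATURE; `FullSituation.ofKits` / `ofKitsGlue` with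
  `statement_iff` (⟺ (i) ∧ (ii)) and `statement_ofKitsGlue_of_statement`. The ONLY free (iii)-argument left is the `∞κ` functor
  `FM` of [IUTchII] Cor. 4.7 (iii) (not yet typed functorially in L6) — plus the kit binders and L6's interface hypotheses
  `hbij hsurj hR h` that `StripFrame.ofKits` / `LatticeGlue.ofKits` themselves carry.
Sources as in J/L (nothing new is read). [claim: Mochizuki2012, status: disputed] Deliberately NOT here: any edit of D/J/L; any judgement.
-/

noncomputable section
noncomputable section

namespace Summit.ABC

namespace IUTFork

namespace Thm311

open CategoryTheory
open Literature.IUT.HodgeTheaters Literature.IUT.HodgeTheaters.PMBaseKit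
open Literature.IUT.LogThetaLattice

universe w v u v₁ u₁ v₂ u₂ v₃ u₃ v₄ u₄ v₅ u₅

/-! ## 0. Smallness of isomorphism types, of `Core C`, and of L6's category of radial data -/

/-- In a locally `w`-small category the isomorphisms `X ≅ Y` form a `w`-small type (they inject into `X ⟶ Y`). [folklore] -/
instance small_iso_of_locallySmall {C : Type u} [Category.{v} C] [LocallySmall.{w} C] (X Y : C) :
    Small.{w} (X ≅ Y) :=
  small_of_injective (f := fun e : X ≅ Y => e.hom) fun _ _ h => Iso.ext h

/-- The core (`Mathlib` `Core C`: same objects, isomorphisms only) of a locally `w`-small category is locally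
`w`-small. [folklore] -/
instance locallySmall_core {C : Type u} [Category.{v} C] [LocallySmall.{w} C] : LocallySmall.{w} (Core C) :=
  ⟨fun X Y => small_of_injective (f := fun f : X ⟶ Y => f.iso) fun _ _ h => CoreHom.ext h⟩

/-- abc-iut-L6-t3's category of radial data `Radial E` ([IUTchIII] Cor. 2.3: a morphism is a pair of isomorphisms, of
`D`-Hodge theaters and of `F⊢×μ`-prime-strips) is locally `0`-small when the frame's `D`-Hodge-theater and
`F⊢×μ`-prime-strip categories are. [folklore] -/
instance locallySmall_radial {S : StripFrame.{u}} [LocallySmall.{0} S.DHT] [LocallySmall.{0} S.Fxm]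
    (E : ThetaCoricData S) : LocallySmall.{0} (Radial E) :=
  ⟨fun R R' => small_of_injective (f := fun f : R ⟶ R' => (f.ξ, f.δ))
    fun _ _ h => Radial.hom_ext (congrArg Prod.fst h) (congrArg Prod.snd h)⟩

/-! ## 1. L's `ofFunctorsCore` in any universe, through the small model -/

namespace LinkData

section

variable {HTC : Type u₁} [Category.{v₁} HTC] {DC : Type u₂} [Category.{v₂} DC] {FC : Type u₃} [Category.{v₃} FC]
  (htToD : HTC ⥤ DC) (H : ℤ × ℤ → HTC) (Dl : ℤ → DC) (ξ : ∀ n m : ℤ, htToD.obj (H (n, m)) ≅ Dl n)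
  (Ffr : HTC ⥤ FC) (Fet : DC ⥤ FC) (kum : Ffr ≅ htToD ⋙ Fet) (Fenv : DC ⥤ FC) (nat : Fet ≅ Fenv)
  {RadC : Type u₄} [Category.{v₄} RadC] (FR : Core DC ⥤ RadC) {KapC : Type u₅} [Category.{v₅} KapC]
  (FM : Core DC ⥤ KapC)
  [LocallySmall.{0} HTC] [LocallySmall.{0} FC] [LocallySmall.{0} RadC] [LocallySmall.{0} KapC]

/-- **The objects of Thm. 3.11 (iii), constructed as in L's `ofFunctorsCore`** (radial data `^{n,∘}R` of Cor. 2.3 and `∞κ`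
data of [IUTchII] Cor. 4.7 (iii) functorial on the CORE of the `D`-Hodge-theater category; permutation-symmetry
poly-isomorphisms = images of the full poly-isomorphism of the core; `Aut(^{n,m}HT)` acting through `D(−)`, `ξ n m` and
`Core.isoMk`) over categories of ANY universe, every object replaced by its index in the small model of its family (J2).
[claim: Mochizuki2012, status: disputed] -/
def ofFunctorsCoreSmall : LinkData where
  Strip := SmallFamily (stripObj H Dl Ffr Fet Fenv)
  Fdelta n m := SmallFamily.mk _ (Sum.inl (n, m))
  FdeltaD n := SmallFamily.mk _ (Sum.inr (Sum.inl n))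
  kumDelta n m := SmallFamily.isoToSmall (obj := stripObj H Dl Ffr Fet Fenv) (i := Sum.inl (n, m))
    (j := Sum.inr (Sum.inl n)) (kumAtU htToD Ffr Fet kum (H (n, m)) ≪≫ Fet.mapIso (ξ n m))
  FenvD n := SmallFamily.mk _ (Sum.inr (Sum.inr n))
  natEnvD n := SmallFamily.isoToSmall (obj := stripObj H Dl Ffr Fet Fenv) (i := Sum.inr (Sum.inl n))
    (j := Sum.inr (Sum.inr n)) (nat.app (Dl n))
  Rad := SmallFamily (fun n : ℤ => FR.obj ⟨Dl n⟩)
  R n := SmallFamily.mk _ n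
  permR n := SmallFamily.toSmall (obj := fun n : ℤ => FR.obj ⟨Dl n⟩) (i := n) (j := n + 1)
    ((PolyIso.full (⟨Dl n⟩ : Core DC) ⟨Dl (n + 1)⟩).map FR)
  Kap := SmallFamily (fun n : ℤ => FM.obj ⟨Dl n⟩)
  Mk n := SmallFamily.mk _ n
  permM n := SmallFamily.toSmall (obj := fun n : ℤ => FM.obj ⟨Dl n⟩) (i := n) (j := n + 1)
    ((PolyIso.full (⟨Dl n⟩ : Core DC) ⟨Dl (n + 1)⟩).map FM)
  AutHT n m := SmallFamily.mk H (n, m) ≅ SmallFamily.mk H (n, m)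
  onDelta n m a := SmallFamily.isoToSmall (obj := stripObj H Dl Ffr Fet Fenv) (i := Sum.inl (n, m))
    (j := Sum.inl (n, m)) (Ffr.mapIso (SmallFamily.isoOfSmall a))
  onDeltaD n m a := SmallFamily.isoToSmall (obj := stripObj H Dl Ffr Fet Fenv) (i := Sum.inr (Sum.inl n))
    (j := Sum.inr (Sum.inl n)) (Fet.mapIso (autDU htToD H Dl ξ n m (SmallFamily.isoOfSmall a)))
  onR n m a := SmallFamily.isoToSmall (obj := fun n : ℤ => FR.obj ⟨Dl n⟩) (i := n) (j := n)
    (FR.mapIso (Core.isoMk (autDU htToD H Dl ξ n m (SmallFamily.isoOfSmall a))))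
  onM n m a := SmallFamily.isoToSmall (obj := fun n : ℤ => FM.obj ⟨Dl n⟩) (i := n) (j := n)
    (FM.mapIso (Core.isoMk (autDU htToD H Dl ξ n m (SmallFamily.isoOfSmall a))))

/-- The transported image of the full poly-isomorphism of the CORE is stabilized by the transported automorphisms
induced through `Core.isoMk` (L's use of `PolyIsoCalc.stabilized_map_full`, moved to the small model). [folklore] -/
theorem stabilized_toSmall_map_full_core {E : Type u} [Category.{v} E] [LocallySmall.{0} E] (G : Core DC ⥤ E)
    (n m : ℤ) :
    PolyIsoCalc.Stabilized
      (SmallFamily.toSmall (obj := fun n : ℤ => G.obj ⟨Dl n⟩) (i := n) (j := n + 1)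
        ((PolyIso.full (⟨Dl n⟩ : Core DC) ⟨Dl (n + 1)⟩).map G))
      {f | ∃ a : SmallFamily.mk H (n, m) ≅ SmallFamily.mk H (n, m),
        f = SmallFamily.isoToSmall (obj := fun n : ℤ => G.obj ⟨Dl n⟩) (i := n) (j := n)
          (G.mapIso (Core.isoMk (autDU htToD H Dl ξ n m (SmallFamily.isoOfSmall a))))}
      {g | ∃ b : SmallFamily.mk H (n + 1, m) ≅ SmallFamily.mk H (n + 1, m),
        g = SmallFamily.isoToSmall (obj := fun n : ℤ => G.obj ⟨Dl n⟩) (i := n + 1) (j := n + 1)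
          (G.mapIso (Core.isoMk (autDU htToD H Dl ξ (n + 1) m (SmallFamily.isoOfSmall b))))} := by
  rintro _ ⟨a, rfl⟩ _ ⟨b, rfl⟩ _ ⟨f, hf, rfl⟩
  obtain ⟨ζ, -, rfl⟩ := PolyIso.mem_map.1 hf
  rw [← SmallFamily.isoToSmall_trans, ← SmallFamily.isoToSmall_trans, SmallFamily.isoToSmall_mem_toSmall]
  exact PolyIso.mem_map.2 ⟨Core.isoMk (autDU htToD H Dl ξ n m (SmallFamily.isoOfSmall a)) ≪≫ ζ ≪≫
      Core.isoMk (autDU htToD H Dl ξ (n + 1) m (SmallFamily.isoOfSmall b)), PolyIso.mem_full _,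
    by rw [Functor.mapIso_trans, Functor.mapIso_trans]⟩

/-- **(iii) (c) AS TYPED holds** for `ofFunctorsCoreSmall` (Kummer naturality, J2 `kum_equivariant`; functoriality on the
core). BOOKKEEPING, neutral. [folklore] -/
theorem ofFunctorsCoreSmall_partIIIc :
    (ofFunctorsCoreSmall htToD H Dl ξ Ffr Fet kum Fenv nat FR FM).PartIIIc := fun n m =>
  ⟨by
    rintro p ⟨a, rfl⟩
    exact SmallFamily.isoToSmall_sq (kum_equivariant htToD H Dl ξ Ffr Fet kum n m (SmallFamily.isoOfSmall a)),
    stabilized_toSmall_map_full_core htToD H Dl ξ FR n m⟩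

/-- **(iii) (d) AS TYPED holds** for `ofFunctorsCoreSmall`. BOOKKEEPING, neutral. [folklore] -/
theorem ofFunctorsCoreSmall_partIIId :
    (ofFunctorsCoreSmall htToD H Dl ξ Ffr Fet kum Fenv nat FR FM).PartIIId := fun n m =>
  stabilized_toSmall_map_full_core htToD H Dl ξ FM n m

/-- (IPL) for `ofFunctorsCoreSmall` from isomorphy of horizontally adjacent Frobenius-like strips. [folklore] -/
theorem ofFunctorsCoreSmall_ipl (h : ∀ n m : ℤ, Nonempty (Ffr.obj (H (n, m)) ≅ Ffr.obj (H (n + 1, m)))) :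
    (ofFunctorsCoreSmall htToD H Dl ξ Ffr Fet kum Fenv nat FR FM).IPL := fun n m => by
  obtain ⟨e⟩ := h n m
  exact ⟨SmallFamily.isoToSmall (obj := stripObj H Dl Ffr Fet Fenv) (i := Sum.inl (n, m))
    (j := Sum.inl (n + 1, m)) e, PolyIso.mem_full _⟩

end

/-! ## 2. Over an L6 glue `G : LatticeGlue S`, `S : StripFrame.{u}`, with Cor. 2.3's radial data -/

section

variable {S : StripFrame.{u}} [LocallySmall.{0} S.HT] [LocallySmall.{0} S.DHT] [LocallySmall.{0} S.Fxm]

/-- A CHOICE of identification `D(^{n,m}HT) ≅ D(^{n,0}HT)` inside the full poly-isomorphism induced by the vertical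
arrows (Thm. 1.5 (i); existence `StripFrame.iso_nonempty_DHT`) — J's `lineIso`, any universe. [claim: Mochizuki2012, status: disputed] -/
def lineIsoU {L : LogStripData S} {T : ThetaLinkData S} (Λ : LogThetaLatticeDiagram L T) (n m : ℤ) :
    S.htToD.obj (Λ.HT (n, m)) ≅ S.htToD.obj (Λ.HT (n, 0)) :=
  (S.iso_nonempty_DHT _ _).some

variable (G : LatticeGlue S) (Λ : LogThetaLatticeDiagram G.logData G.linkData)
  {Kap : Type u₅} [Category.{v₅} Kap] [LocallySmall.{0} Kap] (FM : Core S.DHT ⥤ Kap)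

/-- **The objects of Thm. 3.11 (iii) for an L6 log-theta-lattice over glued §1–§2 data, any universe** — L's
`ofGlueRadial` through the small model: line representatives `^{n,∘}HT^D := D(^{n,0}HT)` along `lineIsoU`; Frobenius-like
`G.biCoric.fxmDeltaHT`, étale-like `G.biCoric.dvDelta ⋙ G.biCoric.fxmOfDv`, Kummer natural isomorphism `G.biCoric.kummer`
(Thm. 1.5 (iii)); `F⊢×μ_env := G.fxmEnvD` with Prop. 2.1 (vi) `:= G.envNat`; radial data `:= Radial.coreFunctor G.coric`
(Cor. 2.3 (ii), L6); `∞κ` data `FM` ([IUTchII] Cor. 4.7 (iii)) the one remaining argument. [claim: Mochizuki2012, status: disputed] -/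
def ofGlueSmall : LinkData :=
  ofFunctorsCoreSmall S.htToD Λ.HT (fun n => S.htToD.obj (Λ.HT (n, 0))) (lineIsoU Λ) G.biCoric.fxmDeltaHT
    (G.biCoric.dvDelta ⋙ G.biCoric.fxmOfDv) G.biCoric.kummer G.fxmEnvD G.envNat (Radial.coreFunctor G.coric) FM

/-- DICTIONARY: the Kummer isomorphism of (iii) (a) for `ofGlueSmall` is the transport of L6's `BiCoricData.kummerAt (^{n,m}HT)`
followed by the transport to the line representative along `lineIsoU` (as L's `ofGlue_kumDelta`). [claim: Mochizuki2012, status: disputed] -/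
theorem ofGlueSmall_kumDelta (n m : ℤ) :
    (ofGlueSmall G Λ FM).kumDelta n m =
      SmallFamily.isoToSmall
        (obj := stripObj Λ.HT (fun n => S.htToD.obj (Λ.HT (n, 0))) G.biCoric.fxmDeltaHT
          (G.biCoric.dvDelta ⋙ G.biCoric.fxmOfDv) G.fxmEnvD)
        (i := Sum.inl (n, m)) (j := Sum.inr (Sum.inl n))
        (G.biCoric.kummerAt (Λ.HT (n, m)) ≪≫
          G.biCoric.fxmOfDv.mapIso (G.biCoric.dvDelta.mapIso (lineIsoU Λ n m))) := rfl

/-- DICTIONARY: the natural isomorphism of (iii) (b) for `ofGlueSmall` is the transport of L6's `LatticeGlue.envNat` (Prop. 2.1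
(vi) `ThetaMonoidData.unitPortionD` along the glue) at the line representative. [claim: Mochizuki2012, status: disputed] -/
theorem ofGlueSmall_natEnvD (n : ℤ) :
    (ofGlueSmall G Λ FM).natEnvD n =
      SmallFamily.isoToSmall
        (obj := stripObj Λ.HT (fun n => S.htToD.obj (Λ.HT (n, 0))) G.biCoric.fxmDeltaHT
          (G.biCoric.dvDelta ⋙ G.biCoric.fxmOfDv) G.fxmEnvD)
        (i := Sum.inr (Sum.inl n)) (j := Sum.inr (Sum.inr n)) (G.envNat.app (S.htToD.obj (Λ.HT (n, 0)))) := rfl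

/-- (iii) (c) and (d) AS TYPED hold for `ofGlueSmall` (every `G`, `Λ`, `FM`, any universe). BOOKKEEPING, neutral. [folklore] -/
theorem ofGlueSmall_partIIIc_partIIId : (ofGlueSmall G Λ FM).PartIIIc ∧ (ofGlueSmall G Λ FM).PartIIId :=
  ⟨ofFunctorsCoreSmall_partIIIc _ _ _ _ _ _ _ _ _ _ FM, ofFunctorsCoreSmall_partIIId _ _ _ _ _ _ _ _ _ _ FM⟩

/-- (IPL) holds for `ofGlueSmall`: the frame's category of `F⊢×μ`-prime-strips is connected (L6-t3's field
`StripFrame.iso_nonempty_Fxm`, "a morphism of prime-strips is a collection of isomorphisms"), so the horizontal full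
poly-isomorphisms are nonempty — LANA Rem. 8.2.1's "connected groupoid", now at a frame of any universe. [folklore] -/
theorem ofGlueSmall_ipl : (ofGlueSmall G Λ FM).IPL :=
  ofFunctorsCoreSmall_ipl _ _ _ _ _ _ _ _ _ _ FM fun _ _ => S.iso_nonempty_Fxm _ _

end

end LinkData

namespace FullSituation

variable {T : ThetaIndex} {S : StripFrame.{u}} [LocallySmall.{0} S.HT] [LocallySmall.{0} S.DHT] [LocallySmall.{0} S.Fxm]
  (G : LatticeGlue S) (Λ : LogThetaLatticeDiagram G.logData G.linkData)
  {Kap : Type u₅} [Category.{v₅} Kap] [LocallySmall.{0} Kap] (FM : Core S.DHT ⥤ Kap)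

/-- **Re-linking.** Theorem 3.11 as typed for a full situation transfers to the SAME (i)/(ii)-data with ANY other
(iii)-objects satisfying (iii)(c)(d) as typed ((iii)(a)(b) are automatic and the evaluation clause follows from (i):
J's `statement_iff_partI_partII_of_link`). In particular every «premise of record» theorem of the cell stated with
`link := LinkData.ofGlueRadial …` over an abstract glue holds verbatim with the (iii)-objects of the REAL glue below.
[folklore] -/
theorem statement_relink (S₁ : FullSituation T) (hS : S₁.Statement) (K : LinkData) (hc : K.PartIIIc)
    (hd : K.PartIIId) : ({ S₁.toLatticeSituation with link := K } : FullSituation T).Statement :=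
  (({ S₁.toLatticeSituation with link := K } : FullSituation T).statement_iff_partI_partII_of_link hc hd).2
    ⟨hS.1, hS.2.1⟩

/-- Theorem 3.11's full situation with (i)/(ii)-data `S₀` and (iii)-objects over an L6 glue of any universe.
[claim: Mochizuki2012, status: disputed] -/
def ofGlueSmall (S₀ : LatticeSituation T) : FullSituation T := { S₀ with link := LinkData.ofGlueSmall G Λ FM }

/-- **Theorem 3.11 as typed over these objects is (i) ∧ (ii)** (as L's `statement_iff_of_glue`, any universe). [folklore] -/
theorem ofGlueSmall_statement_iff (S₀ : LatticeSituation T) :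
    (ofGlueSmall G Λ FM S₀).Statement ↔ S₀.PartI ∧ S₀.PartII :=
  (ofGlueSmall G Λ FM S₀).statement_iff_partI_partII_of_link (LinkData.ofGlueSmall_partIIIc_partIIId G Λ FM).1
    (LinkData.ofGlueSmall_partIIIc_partIIId G Λ FM).2

end FullSituation

/-! ## 3. Over the REAL glue `LatticeGlue.ofKits` on the REAL frame `StripFrame.ofKits` -/

section Kits

variable {l : ℕ} {K : PMBaseKit.{0} l} {M : K.MultKit} {FK : K.FKit M} (L : FK.MonoLaws)
  (hbij : FK.IsomFtoDBijective) (hsurj : FK.IsomFmtoDmSurjective) (hR : FK.RlfOfIsStrip) (X : TimesMuSide FK L)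
  (h : ∀ A B : X.Fglxm, Function.Surjective (fun g : A ≅ B => (X.FglxmToFvtxm ⋙ X.FvtxmToFxm).mapIso g))
  (Gk : LatticeGlueKit hR X) (kind : LatticeKind) (Hk : ℤ × ℤ → FK.ThetaPMEllHT) (hH : Function.Injective Hk)

/-- The Hodge-theater category of the real frame (kits in universe `0`: `AsSmall.{1} (HTRep FK)`, morphisms in `Type`) is
locally `0`-small. [folklore] -/
instance locallySmall_ofKits_HT : LocallySmall.{0} (StripFrame.ofKits L hbij hsurj hR X).HT :=
  show LocallySmall.{0} (AsSmall (HTRep FK)) from inferInstance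

/-- The `F⊢×μ`-prime-strip category of the real frame (`AsSmall.{1} X.Fxm`) is locally `0`-small. [folklore] -/
instance locallySmall_ofKits_Fxm : LocallySmall.{0} (StripFrame.ofKits L hbij hsurj hR X).Fxm :=
  show LocallySmall.{0} (AsSmall X.Fxm) from inferInstance

/-- The `D`-Hodge-theater category of the real frame (`AsSmall.{1} (DHTRep K)`) is locally `0`-small. [folklore] -/
instance locallySmall_ofKits_DHT : LocallySmall.{0} (StripFrame.ofKits L hbij hsurj hR X).DHT :=
  show LocallySmall.{0} (AsSmall (DHTRep K)) from inferInstance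

variable {Kap : Type u₅} [Category.{v₅} Kap] [LocallySmall.{0} Kap]
  (FM : Core (StripFrame.ofKits L hbij hsurj hR X).DHT ⥤ Kap)

namespace LinkData

section BiCoric

variable (Bk : BiCoricKit X) (H : ℤ × ℤ → (StripFrame.ofKits L hbij hsurj hR X).HT)
  (Dl : ℤ → (StripFrame.ofKits L hbij hsurj hR X).DHT)
  (ξ : ∀ n m : ℤ, (StripFrame.ofKits L hbij hsurj hR X).htToD.obj (H (n, m)) ≅ Dl n)
  (Fenv : (StripFrame.ofKits L hbij hsurj hR X).DHT ⥤ (StripFrame.ofKits L hbij hsurj hR X).Fxm)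
  (nat : (BiCoricData.ofKits L hbij hsurj hR X Bk).dvDelta ⋙ (BiCoricData.ofKits L hbij hsurj hR X Bk).fxmOfDv ≅ Fenv)
  {Rad : Type u₄} [Category.{v₄} Rad] [LocallySmall.{0} Rad] (FR : (StripFrame.ofKits L hbij hsurj hR X).DHT ⥤ Rad)
  (FM' : (StripFrame.ofKits L hbij hsurj hR X).DHT ⥤ Kap)

/-- **The objects of [IUTchIII] Thm. 3.11 (iii) over the REAL frame** `StripFrame.ofKits` with the REAL bi-coric data
`BiCoricData.ofKits` (Frobenius-like `^{n,m}F⊢×μ_△ := fxmDeltaHT (^{n,m}HT)`, étale-like `F⊢×μ_△(^{n,∘}D⊢_△)`, the Kummer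
isomorphisms of Thm. 1.5 (iii) from the kit), as a `Thm311.LinkData` via J2's `ofBiCoricSmall`; `Fenv`/`nat`, `FR`, `FM` generic
(the glue-level `ofKitsGlue` below fixes the first two). [claim: Mochizuki2012, status: disputed] -/
def ofKits : LinkData :=
  ofBiCoricSmall (BiCoricData.ofKits L hbij hsurj hR X Bk) H Dl ξ Fenv nat FR FM'

/-- (iii) (c) and (d) AS TYPED hold for the (iii)-objects over the real frame (J2). [folklore] -/
theorem ofKits_partIIIc_partIIId :
    (ofKits L hbij hsurj hR X Bk H Dl ξ Fenv nat FR FM').PartIIIc ∧ (ofKits L hbij hsurj hR X Bk H Dl ξ Fenv nat FR FM').PartIIId :=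
  ⟨ofBiCoricSmall_partIIIc _ H Dl ξ Fenv nat FR FM', ofBiCoricSmall_partIIId _ H Dl ξ Fenv nat FR FM'⟩

end BiCoric

/-- **The objects of [IUTchIII] Thm. 3.11 (iii) over the REAL glued §1–§2 data**: abc-iut-L6-t3's `LatticeGlue.ofKits`
(real bi-coric data, real theta monoids with Prop. 2.1 (vi), real radial data of Cor. 2.3) on `StripFrame.ofKits`, with the
log-theta-lattice `LatticeGlue.ofKitsDiagram` of any injective family `Hk` of `Θ^{±ell}`-Hodge theaters over the kits — as a
`Thm311.LinkData` (D's universe-`0` signature). Free: the `∞κ` functor `FM`. [claim: Mochizuki2012, status: disputed] -/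
def ofKitsGlue : LinkData :=
  ofGlueSmall (LatticeGlue.ofKits L hbij hsurj hR X h Gk) (LatticeGlue.ofKitsDiagram L hbij hsurj hR X h Gk kind Hk hH) FM

/-- (iii) (c) and (d) AS TYPED hold for the (iii)-objects over the real glue. BOOKKEEPING, neutral. [folklore] -/
theorem ofKitsGlue_partIIIc_partIIId :
    (ofKitsGlue L hbij hsurj hR X h Gk kind Hk hH FM).PartIIIc ∧ (ofKitsGlue L hbij hsurj hR X h Gk kind Hk hH FM).PartIIId :=
  ofGlueSmall_partIIIc_partIIId _ _ FM

/-- The horizontal arrows over the real glue are the full poly-isomorphisms (Def. 3.8 (ii) / Thm. 1.5 (ii)).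
[claim: Mochizuki2012, status: disputed] -/
theorem ofKitsGlue_horizontal (n m : ℤ) :
    (ofKitsGlue L hbij hsurj hR X h Gk kind Hk hH FM).horizontal n m = PolyIso.full _ _ := rfl

/-- (IPL) holds for the (iii)-objects over the real glue (the real `F⊢×μ`-prime-strip category is connected). [folklore] -/
theorem ofKitsGlue_ipl : (ofKitsGlue L hbij hsurj hR X h Gk kind Hk hH FM).IPL :=
  ofGlueSmall_ipl _ _ FM

end LinkData

namespace FullSituation

variable {T : ThetaIndex}

/-- Theorem 3.11's full situation with (i)/(ii)-data `S₀` and (iii)-objects over the REAL glue. [claim: Mochizuki2012, status: disputed] -/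
def ofKitsGlue (S₀ : LatticeSituation T) : FullSituation T :=
  ofGlueSmall (LatticeGlue.ofKits L hbij hsurj hR X h Gk) (LatticeGlue.ofKitsDiagram L hbij hsurj hR X h Gk kind Hk hH) FM S₀

/-- **Theorem 3.11 as typed over the (iii)-objects of the REAL glue is (i) ∧ (ii).** [folklore] -/
theorem ofKitsGlue_statement_iff (S₀ : LatticeSituation T) :
    (ofKitsGlue L hbij hsurj hR X h Gk kind Hk hH FM S₀).Statement ↔ S₀.PartI ∧ S₀.PartII :=
  ofGlueSmall_statement_iff _ _ FM S₀

/-- **Re-linking at the REAL glue**: if Theorem 3.11 as typed holds for a full situation `S₁` (e.g. the cell's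
«premise of record» instantiations `Thm311.Real.full_statement_Pr_LGP` / `full_statement_print_arch` /
`full_statement_honest`, stated over an abstract glue), it holds for `S₁`'s (i)/(ii)-data equipped with the
(iii)-objects of the REAL glue `LatticeGlue.ofKits`. [folklore] -/
theorem statement_ofKitsGlue_of_statement (S₁ : FullSituation T) (hS : S₁.Statement) :
    (ofKitsGlue L hbij hsurj hR X h Gk kind Hk hH FM S₁.toLatticeSituation).Statement :=
  statement_relink S₁ hS _ (LinkData.ofKitsGlue_partIIIc_partIIId L hbij hsurj hR X h Gk kind Hk hH FM).1
    (LinkData.ofKitsGlue_partIIIc_partIIId L hbij hsurj hR X h Gk kind Hk hH FM).2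

end FullSituation

end Kits

end Thm311

end IUTFork

end Summit.ABC

end
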